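import Summits.BirchSwinnertonDyer.BirchSwinnertonDyer.Theorems.ByReductionTypeAtTwoMultTransportTwistedDescentDualControl
import Summits.BirchSwinnertonDyer.BirchSwinnertonDyer.Theorems.ByReductionTypeAtTwoMultTransportTwistedDescentPT
import Literature.NumberTheory.EllipticCurves.ZpExtensionGaloisTwistLevelProofs
import Literature.NumberTheory.EllipticCurves.ZpExtensionGaloisTwistLevelDualProofs
import Literature.NumberTheory.EllipticCurves.ZpExtensionGaloisTwistExponentProofs
import Literature.NumberTheory.EllipticCurves.ZpExtensionGaloisTwistLocalLiftProofs
import Literature.NumberTheory.EllipticCurves.ZpExtensionTwistedEigenvectorFiniteProofs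
import Literature.NumberTheory.EllipticCurves.IwasawaTwistedInvariantsFiniteProofs
import Literature.NumberTheory.EllipticCurves.Greenberg1999.CyclotomicTorsionFiniteHolds
import Literature.NumberTheory.EllipticCurves.Greenberg1999.LocalH1DivisibleCyclotomicProofs
import Literature.NumberTheory.EllipticCurves.PointDivisibilityProofs
import Literature.NumberTheory.EllipticCurves.WeilPairingProofs
import HarnessLib

/-!
# T-42-mult in the kernel, XXIV-a: elementary helpers for the assembly of `LIFT₃` (uniform exponents, odd
# inverses mod `2^J`, small twisted invariants of the Tate dual)

Cell `bsd-2adic` (run/shared/lean/pub/bsd-2adic/), seat `bsd-2adic-t42` (BRIEF-T42), GEN 16. HONEST FRAMING: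
research route; THEOREMS ONLY (no `def`, no named fact, no instance); nothing booked; nothing re-keyed
(RC-169); BSD is not proved by any of this. PARTITION: X5@2 multiplicative GV-transport rows (K4ᵐ B1·O1; the
residual `LIFT₃` of `hF3b`) × p = 2 — types-the-object-of; bears_on K4 items 19922 / 19923
(`--supports stmt-BirchSwinnertonDyer-19923`). Helpers of file XXIV `…TwistedDescentLocal.lean`
(HOME/t42/DESIGN-T42-ADDENDUM-17.md): `exists_odd_inverse_mod_two_pow`, `exists_uniform_pow_smul_eq_zero`,
`exists_pow_smul_fixedPoints_eq_zero` (`2^b` kills `E(ℚ_∞)[2^∞]`, Imai–Ribet over the cyclotomic tower),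
`exists_pow_smul_eigen_eq_zero` (`2^a` kills the `u`-eigenvectors of `conj_γ` in `Sel_∞` off Greenberg's finite
set), `pow_smul_tateDual_eq_zero_of_fixed` (Greenberg p. 125 «`H⁰(F_{v₀}, M^*)` finite», read through the
twisted Weil duality).

References: [GreenbergLNM1716] §3 p. 86, §4 pp. 123–125; [SilvermanAEC2009] III.8.1.
-/

set_option autoImplicit false
set_option linter.dupNamespace false

noncomputable section

open scoped Classical ContRepresentation

universe u

namespace Summit.BirchSwinnertonDyer.BirchSwinnertonDyer.Theorems.MultTransportTwistedDescent

open NumberField IsDedekindDomain Field WeierstrassCurve CategoryTheory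
  Literature.NumberTheory.EllipticCurves Literature.NumberTheory.EllipticCurves.GreenbergVatsal2000
  Literature.NumberTheory.EllipticCurves.Greenberg1999
  Literature.NumberTheory.GaloisRepresentations Literature.NumberTheory.GaloisCohomology
  Summit.BirchSwinnertonDyer.BirchSwinnertonDyer.Theorems.MultTransportAtTwo
open Literature.NumberTheory.GaloisRepresentations.DiscreteGaloisModule (localTatePairingZMod
  unramifiedSubgroup SelmerStructure TateDual)

/-! ## §0 Elementary helpers -/

/-- An odd integer is invertible modulo every power of `2`, with an odd inverse. [folklore] -/
theorem exists_odd_inverse_mod_two_pow {u : ℤ} (hu : (2 : ℤ) ∣ u - 1) (J : ℕ) :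
    ∃ u' : ℤ, (2 : ℤ) ∣ u' - 1 ∧ ((2 : ℤ) ^ J) ∣ u * u' - 1 := by
  have hcop : IsCoprime u 2 := by
    obtain ⟨k, hk⟩ := hu
    refine ⟨1, -k, ?_⟩
    linear_combination hk
  obtain ⟨a, b, hab⟩ := (hcop.pow_right (n := J + 1))
  refine ⟨a, ?_, ?_⟩
  · -- `a - 1 = (u a - 1) - a (u - 1)`, both even
    have h1 : (2 : ℤ) ∣ u * a - 1 := by
      refine ⟨-(b * 2 ^ J), ?_⟩
      rw [pow_succ] at hab
      linear_combination hab
    have h2 : (2 : ℤ) ∣ a * (u - 1) := hu.mul_left a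
    have : a - 1 = (u * a - 1) - a * (u - 1) := by ring
    rw [this]
    exact dvd_sub h1 h2
  · refine (pow_dvd_pow (2 : ℤ) (Nat.le_add_right J 1)).trans ⟨-b, ?_⟩
    linear_combination hab

/-- A finite set of elements each killed by a power of `p` has a uniform exponent. [folklore] -/
theorem exists_uniform_pow_smul_eq_zero {M : Type u} [AddCommMonoid M] (p : ℕ) {s : Set M} (hs : s.Finite)
    (htor : ∀ x ∈ s, ∃ k : ℕ, p ^ k • x = 0) : ∃ b : ℕ, ∀ x ∈ s, p ^ b • x = 0 := by
  let k : M → ℕ := fun x ↦ if hx : x ∈ s then Classical.choose (htor x hx) else 0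
  have hk : ∀ x ∈ s, p ^ k x • x = 0 := fun x hx ↦ by
    simp only [k, dif_pos hx]
    exact Classical.choose_spec (htor x hx)
  refine ⟨hs.toFinset.sup k, fun x hx ↦ ?_⟩
  have hle : k x ≤ hs.toFinset.sup k := Finset.le_sup (hs.mem_toFinset.mpr hx)
  obtain ⟨d, hd⟩ := Nat.exists_eq_add_of_le hle
  rw [hd, pow_add, mul_comm, mul_smul, hk x hx, smul_zero]

variable (W : WeierstrassCurve ℚ) [W.IsElliptic] (κ : ZpExtension ℚ 2)

/-- `2^b` kills `E(ℚ_∞)[2^∞]` for some `b` (Imai–Ribet finiteness over the cyclotomic `ℤ₂`-extension, tree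
`finite_torsion_cyclotomicZpExtension_holds`, made uniform). [cite: GreenbergLNM1716, §3 p. 86] -/
theorem exists_pow_smul_fixedPoints_eq_zero (hκ : κ.IsCyclotomic) :
    ∃ b : ℕ, ∀ P : W.geomPrimaryTorsion 2, (∀ h : κ.kerSubgroup, h • P = P) → 2 ^ b • P = 0 := by
  haveI := finite_torsion_cyclotomicZpExtension_holds W 2 κ hκ
  have hfin : {P : W.geomPrimaryTorsion 2 | ∀ h : κ.kerSubgroup, h • P = P}.Finite := by
    have : {P : W.geomPrimaryTorsion 2 | ∀ h : κ.kerSubgroup, h • P = P} =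
        Subtype.val '' (Set.univ : Set (FixedPoints.addSubgroup κ.kerSubgroup (W.geomPrimaryTorsion 2))) := by
      ext P
      simp only [Set.mem_setOf_eq, Set.image_univ, Set.mem_range, Subtype.exists, exists_prop,
        exists_eq_right]
      rfl
    rw [this]
    exact Set.finite_univ.image _
  refine exists_uniform_pow_smul_eq_zero 2 hfin fun P _ ↦ ?_
  obtain ⟨k, hk⟩ := P.2
  exact ⟨k, Subtype.ext (by rw [AddSubmonoidClass.coe_nsmul]; exact hk)⟩

omit [W.IsElliptic] in
/-- For `u` outside Greenberg's finite exceptional set, `2^a` kills the `u`-eigenvectors of `conj_γ` in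
`Sel_{2^∞}(E/ℚ_∞)` for some `a`. [cite: GreenbergLNM1716, §4 p. 124] -/
theorem exists_pow_smul_eigen_eq_zero {γ : absoluteGaloisGroup ℚ} {u : ℤ}
    (hfin : {s : W.selmerInfty κ |
      W.conjH1 2 κ.kerSubgroup γ (s : W.subgroupH1 2 κ.kerSubgroup) =
        u • (s : W.subgroupH1 2 κ.kerSubgroup)}.Finite) :
    ∃ a : ℕ, ∀ s ∈ W.selmerInfty κ, W.conjH1 2 κ.kerSubgroup γ s = u • s → 2 ^ a • s = 0 := by
  have hfin' : {s : W.subgroupH1 2 κ.kerSubgroup | s ∈ W.selmerInfty κ ∧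
      W.conjH1 2 κ.kerSubgroup γ s = u • s}.Finite := by
    have : {s : W.subgroupH1 2 κ.kerSubgroup | s ∈ W.selmerInfty κ ∧ W.conjH1 2 κ.kerSubgroup γ s = u • s} =
        Subtype.val '' {s : W.selmerInfty κ |
          W.conjH1 2 κ.kerSubgroup γ (s : W.subgroupH1 2 κ.kerSubgroup) =
            u • (s : W.subgroupH1 2 κ.kerSubgroup)} := by
      ext s
      simp only [Set.mem_setOf_eq, Set.mem_image, Subtype.exists, exists_and_right, exists_eq_right]
      constructor
      · rintro ⟨h1, h2⟩; exact ⟨h1, h2⟩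
      · rintro ⟨h1, h2⟩; exact ⟨h1, h2⟩
    rw [this]
    exact hfin.image _
  obtain ⟨a, ha⟩ := exists_uniform_pow_smul_eq_zero 2 hfin' fun s _ ↦
    W.exists_pow_smul_subgroupH1_ker_eq_zero κ s
  exact ⟨a, fun s hs h ↦ ha s ⟨hs, h⟩⟩

/-- **Twisted invariants of the Tate dual are small.** If `2^f` kills every `P ∈ E[2^J]` with
`σ₀ • P = u^{κ(σ₀)} • P` (`σ₀ = res σ₂`), then `2^f` kills every element of `E[2^J](χ_u)^D` fixed by `σ₂` — read
through the Weil duality `w : E[2^J](χ_{u'}) ⥲ E[2^J](χ_u)^D` (`u u' ≡ 1`): `w` intertwines, and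
`u'^{κ σ₀} σ₀ T = T` iff `σ₀ T = u^{κ σ₀} T`. (Greenberg p. 125 «`H⁰(F_{v₀}, M^*)` … finite».)
[cite: GreenbergLNM1716, §4 p. 125] -/
theorem pow_smul_tateDual_eq_zero_of_fixed (J : ℕ) {u u' : ℤ} (hu : (2 : ℤ) ∣ u - 1) (hu' : (2 : ℤ) ∣ u' - 1)
    (huu' : ((2 : ℤ) ^ J) ∣ u * u' - 1)
    (e : W.geomTorsion ((2 ^ J : ℕ) : ℤ) → W.geomTorsion ((2 ^ J : ℕ) : ℤ) → AlgebraicClosure ℚ)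
    (hμ : ∀ S T, e S T ^ (2 ^ J) = 1)
    (hadd₁ : ∀ S₁ S₂ T, e (S₁ + S₂) T = e S₁ T * e S₂ T)
    (hadd₂ : ∀ S T₁ T₂, e S (T₁ + T₂) = e S T₁ * e S T₂)
    (hgal : ∀ (σ : absoluteGaloisGroup ℚ) (S T : W.geomTorsion ((2 ^ J : ℕ) : ℤ)),
      σ • e S T = e (σ • S) (σ • T))
    (hnondeg : ∀ T, (∀ S, e S T = 1) → T = 0) [Finite (W.geomTorsion ((2 ^ J : ℕ) : ℤ))]
    {E : Type} [Field E] [Algebra ℚ E] (σ₂ : absoluteGaloisGroup E) {f : ℕ}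
    (hf : ∀ P : W.geomTorsion ((2 ^ J : ℕ) : ℤ),
      absGaloisRestrict ℚ E σ₂ • P = (u ^ κ.twistExponent J (absGaloisRestrict ℚ E σ₂)) • P → 2 ^ f • P = 0)
    (m : TateDual ℚ (W.geomTorsion ((2 ^ J : ℕ) : ℤ)) (2 ^ J))
    (hm : ∀ σ : absoluteGaloisGroup E,
      (W.twistedTorsionGaloisModule 2 κ J u hu).tateDual (2 ^ J) (absGaloisRestrict ℚ E σ) m = m) :
    ((2 ^ f : ℕ) : ℤ) • m = 0 := by
  set wJ := W.twistedWeilDual 2 κ J hu hu' huu' e hμ hadd₁ hadd₂ hgal with hwJ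
  set T := W.twistedWeilDualInv 2 κ J hu hu' huu' e hμ hadd₁ hadd₂ hgal hnondeg m with hT
  have hmT : wJ T = m := W.twistedWeilDual_inv_apply 2 κ J hu hu' huu' e hμ hadd₁ hadd₂ hgal hnondeg m
  set g := absGaloisRestrict ℚ E σ₂ with hg
  -- `ρ_{u'}(g) T = T`
  have h1 : W.twistedTorsionGaloisModule 2 κ J u' hu' g T = T := by
    apply W.twistedWeilDual_injective 2 κ J hu hu' huu' e hμ hadd₁ hadd₂ hgal hnondeg
    have h := congrArg (fun L ↦ L T) (wJ.isIntertwining' g)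
    change wJ (W.twistedTorsionGaloisModule 2 κ J u' hu' g T) =
      ((W.twistedTorsionGaloisModule 2 κ J u hu).tateDual (2 ^ J)) g (wJ T) at h
    rw [h, hmT]
    exact hm σ₂
  -- hence `g • T = u^{e} • T`
  rw [ZpExtension.galoisTwist_apply_apply, torsionGaloisModule_apply_apply] at h1
  have h2 : g • T = (u ^ κ.twistExponent J g) • T := by
    have h3 := congrArg (fun X ↦ (u ^ κ.twistExponent J g) • X) h1
    rw [smul_smul, ← mul_pow,
      ZpExtension.pow_zsmul_eq_of_dvd_sub (W.pow_nsmul_geomTorsion_pow 2 J) huu', one_pow, one_smul] at h3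
    exact h3
  have h4 : 2 ^ f • T = 0 := hf T h2
  rw [← hmT, ← map_zsmul, natCast_zsmul, h4, map_zero]



end Summit.BirchSwinnertonDyer.BirchSwinnertonDyer.Theorems.MultTransportTwistedDescent

end
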